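import Mathlib
import Summits.Ventures.PercRepro2.Defs
import Summits.Ventures.PercRepro2.Graph
import Summits.Ventures.PercRepro2.DisagreementSum
import Summits.Ventures.PercRepro2.DisagreementPinned
import Summits.Ventures.PercRepro2.TwoCopyBHK
import Summits.Ventures.PercRepro2.NestedMaskBHK

/-!
# The one-extra-vertex reduction for nested masks
(blind cell PercRepro2, mine-1 g24; `proofs/MINE1-J1.md` §29(b); companion of `NestedMaskBHK.lean`)

A nested pair of masks `(insert v m, m)` whose extra vertex `v` is joined to a vertex `u ∈ m` by an
edge `f` of the graph is **half a symmetric pair `(m, m)`** on the minor with `f` free: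

  `pinnedCount (insert f G) z (K_{m,m}) = 2 · pinnedCount G (z with f closed) (K_{insert v m, m})`

for every pair kernel and for the side-sign kernel (`pinnedCount_insert_pairKernel`,
`pinnedCount_insert_sideKernel`). Two ingredients:

* `pinnedCount_insert_eq_two_mul` — the generic splitting of a complementary-pair count on
  `insert f G` by the colour of `f`: for a SYMMETRIC kernel the `f`-red and `f`-blue halves agree
  (the colour swap `flipOn (insert f G)` is an involution of the minor's configurations), and the
  `f`-red half is the count on `G`, with `f` pinned closed, of the kernel read with `f` re-opened in
  the red copy (the bijection `x ↦ update x f false`);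
* `maskedGraph_update_true_reachable_iff` — opening `f = u–v` (`u ∈ m`) in a copy has exactly the
  reachability of enlarging that copy's mask by `v` (the clique on `insert v m` adds the adjacencies
  `v–w`, `w ∈ m`, each realised by `v –f– u –clique– w`).

Consequence (`nested_pair_nonneg_of_symmetric`, `nested_side_nonneg_of_symmetric`): the nested-mask
statements of `NestedMaskBHK.lean` for pairs with `|m ∖ m'| ≤ 1` follow from the SYMMETRIC (`m = m'`)
statements on the graph with the extra edge — so the first genuinely new content of
(MBHK-1.x-nested) / `NestedSideCount` sits at `|m ∖ m'| = 2` (`MINE1-J1.md` §29(b)(1)–(2)). The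
symmetric statements themselves (typed BHK 1.3 / 1.4, p1's `CrossCount` and its same-cluster twin)
remain conjectures.
-/

namespace Summit.Ventures.PercRepro2

namespace NestedMask

section Split

variable {E : Type*} [Fintype E] [DecidableEq E] {R : Type*} [CommRing R]

omit [Fintype E] in
/-- `flipOn` is an involution. -/
lemma flipOn_flipOn (G : Finset E) (x : Config E) : flipOn G (flipOn G x) = x := by
  funext e
  by_cases he : e ∈ G <;> simp [flipOn, he]

omit [Fintype E] in
/-- Off `G`, `flipOn G x` agrees with `z` iff `x` does. -/
lemma forall_notMem_flipOn_iff {G : Finset E} {x z : Config E} :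
    (∀ e, e ∉ G → flipOn G x e = z e) ↔ (∀ e, e ∉ G → x e = z e) := by
  constructor
  · intro h e he
    have := h e he
    rwa [flipOn_of_notMem G x he] at this
  · intro h e he
    rw [flipOn_of_notMem G x he]
    exact h e he

omit [Fintype E] in
/-- With `f` open in `x`, flipping on `insert f G` is flipping on `G` after closing `f`. -/
lemma flipOn_insert_of_true {G : Finset E} {f : E} (hfG : f ∉ G) {x : Config E} (hx : x f = true) :
    flipOn (insert f G) x = flipOn G (Function.update x f false) := by
  funext e
  by_cases he : e = f
  · subst he
    simp [flipOn, hfG, hx]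
  · simp [flipOn, he, Finset.mem_insert]

/-- **Splitting the complementary-pair count on `insert f G` by the colour of `f`.** For a symmetric
kernel the `f`-red and `f`-blue halves agree (the colour swap), and the `f`-red half is the count on
`G`, with `f` pinned closed, of the kernel read with `f` re-opened in the red copy. -/
theorem pinnedCount_insert_eq_two_mul {G : Finset E} {f : E} (hfG : f ∉ G) (z : Config E)
    (K : Config E → Config E → R) (hK : ∀ x y, K x y = K y x) :
    pinnedCount (insert f G) z K =
      2 * pinnedCount G (Function.update z f false) (fun x y => K (Function.update x f true) y) := by
  classical
  have hfS : f ∈ insert f G := Finset.mem_insert_self f G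
  -- the count as a sum over the filtered configurations
  have key : ∀ (S : Finset E) (z : Config E) (K : Config E → Config E → R),
      pinnedCount S z K =
        ∑ x ∈ Finset.univ.filter (fun x : Config E => ∀ e, e ∉ S → x e = z e), K x (flipOn S x) := by
    intro S z K
    unfold pinnedCount
    rw [Finset.sum_filter]
  rw [key, key]
  set A := Finset.univ.filter (fun x : Config E => ∀ e, e ∉ insert f G → x e = z e) with hA
  set B := Finset.univ.filter
    (fun x : Config E => ∀ e, e ∉ G → x e = Function.update z f false e) with hB
  rw [← Finset.sum_filter_add_sum_filter_not A (fun x : Config E => x f = true)]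
  -- the two halves agree
  have hswap : ∑ x ∈ A.filter (fun x => ¬ x f = true), K x (flipOn (insert f G) x) =
      ∑ x ∈ A.filter (fun x => x f = true), K x (flipOn (insert f G) x) := by
    refine Finset.sum_nbij' (flipOn (insert f G)) (flipOn (insert f G)) ?_ ?_ ?_ ?_ ?_
    · intro x hx
      simp only [hA, Finset.mem_filter, Finset.mem_univ, true_and] at hx ⊢
      refine ⟨forall_notMem_flipOn_iff.2 hx.1, ?_⟩
      rw [flipOn_of_mem _ _ hfS]
      cases h : x f
      · rfl
      · exact absurd h hx.2
    · intro x hx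
      simp only [hA, Finset.mem_filter, Finset.mem_univ, true_and] at hx ⊢
      refine ⟨forall_notMem_flipOn_iff.2 hx.1, ?_⟩
      rw [flipOn_of_mem _ _ hfS, hx.2]
      simp
    · intro x _
      exact flipOn_flipOn _ _
    · intro x _
      exact flipOn_flipOn _ _
    · intro x _
      rw [flipOn_flipOn, hK]
  rw [hswap, ← two_mul]
  congr 1
  -- the `f`-red half is the count on `G`
  refine Finset.sum_nbij' (fun x => Function.update x f false) (fun x => Function.update x f true)
    ?_ ?_ ?_ ?_ ?_
  · intro x hx
    simp only [hA, hB, Finset.mem_filter, Finset.mem_univ, true_and] at hx ⊢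
    intro e he
    by_cases hef : e = f
    · subst hef
      simp
    · rw [Function.update_of_ne hef, Function.update_of_ne hef]
      exact hx.1 e (by simp [hef, he])
  · intro x hx
    simp only [hA, hB, Finset.mem_filter, Finset.mem_univ, true_and] at hx ⊢
    refine ⟨fun e he => ?_, by simp⟩
    have hef : e ≠ f := fun h => he (h ▸ hfS)
    have heG : e ∉ G := fun h => he (Finset.mem_insert_of_mem h)
    rw [Function.update_of_ne hef]
    have := hx e heG
    rwa [Function.update_of_ne hef] at this
  · intro x hx
    simp only [hA, Finset.mem_filter, Finset.mem_univ, true_and] at hx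
    rw [Function.update_idem, ← hx.2, Function.update_eq_self]
  · intro x hx
    simp only [hB, Finset.mem_filter, Finset.mem_univ, true_and] at hx
    have hxf : x f = false := by
      have := hx f hfG
      simpa using this
    rw [Function.update_idem, ← hxf, Function.update_eq_self]
  · intro x hx
    simp only [hA, Finset.mem_filter, Finset.mem_univ, true_and] at hx
    rw [flipOn_insert_of_true hfG hx.2, Function.update_idem, ← hx.2, Function.update_eq_self]

end Split

section Shift

variable {V : Type*} {E : Type*} [DecidableEq V]

/-- Opening the edge `f = u–v` with `u ∈ m` in a copy gives the reachability of the copy with the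
mask enlarged by `v`. -/
lemma maskedGraph_update_true_reachable_iff {ends : E → Sym2 V} {m : Finset V} {u v : V}
    (hu : u ∈ m) (huv : u ≠ v) {f : E} (hf : ends f = s(u, v)) [DecidableEq E] (x : Config E)
    (a b : V) :
    (maskedGraph ends m (Function.update x f true)).Reachable a b ↔
      (maskedGraph ends (insert v m) x).Reachable a b := by
  constructor
  · -- every adjacency on the left is an adjacency on the right
    refine SimpleGraph.Reachable.mono ?_
    intro a b hab
    simp only [maskedGraph, SimpleGraph.sup_adj, openGraph_adj, cliqueGraph_adj] at hab ⊢
    rcases hab with ⟨hne, e, he, hends⟩ | ⟨hne, ha, hb⟩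
    · by_cases hef : e = f
      · subst hef
        rw [hf] at hends
        right
        refine ⟨hne, ?_⟩
        rcases Sym2.eq_iff.1 hends with ⟨rfl, rfl⟩ | ⟨rfl, rfl⟩
        · exact ⟨Finset.mem_insert_of_mem hu, Finset.mem_insert_self _ _⟩
        · exact ⟨Finset.mem_insert_self _ _, Finset.mem_insert_of_mem hu⟩
      · left
        rw [Function.update_of_ne hef] at he
        exact ⟨hne, e, he, hends⟩
    · right
      exact ⟨hne, Finset.mem_insert_of_mem ha, Finset.mem_insert_of_mem hb⟩
  · -- every adjacency on the right is reachable on the left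
    intro h
    rw [SimpleGraph.reachable_iff_reflTransGen] at h
    have hadj : ∀ {a b : V}, (maskedGraph ends (insert v m) x).Adj a b →
        (maskedGraph ends m (Function.update x f true)).Reachable a b := by
      intro a b hab
      simp only [maskedGraph, SimpleGraph.sup_adj, openGraph_adj, cliqueGraph_adj] at hab
      -- the edge `f`, open in the red copy, joins `u` and `v`
      have hfuv : (maskedGraph ends m (Function.update x f true)).Adj u v := by
        simp only [maskedGraph, SimpleGraph.sup_adj, openGraph_adj]
        left
        exact ⟨huv, f, by simp, hf⟩
      -- vertices of `m` are adjacent or equal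
      have hm : ∀ {a b : V}, a ∈ m → b ∈ m →
          (maskedGraph ends m (Function.update x f true)).Reachable a b := by
        intro a b ha hb
        by_cases hab : a = b
        · subst hab; exact SimpleGraph.Reachable.refl a
        · exact SimpleGraph.Adj.reachable (by
            simp only [maskedGraph, SimpleGraph.sup_adj, cliqueGraph_adj]
            exact Or.inr ⟨hab, ha, hb⟩)
      rcases hab with ⟨hne, e, he, hends⟩ | ⟨hne, ha, hb⟩
      · refine SimpleGraph.Adj.reachable ?_
        simp only [maskedGraph, SimpleGraph.sup_adj, openGraph_adj]
        left
        refine ⟨hne, e, ?_, hends⟩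
        by_cases hef : e = f
        · subst hef; simp
        · rw [Function.update_of_ne hef]; exact he
      · rw [Finset.mem_insert] at ha hb
        rcases ha with rfl | ha <;> rcases hb with rfl | hb
        · exact absurd rfl hne
        · -- `a = v`, `b ∈ m`: `v –f– u –m– b`
          exact (SimpleGraph.Adj.reachable hfuv.symm).trans (hm hu hb)
        · -- `a ∈ m`, `b = v`
          exact (hm ha hu).trans (SimpleGraph.Adj.reachable hfuv)
        · exact hm ha hb
    induction h with
    | refl => exact SimpleGraph.Reachable.refl _
    | tail _ hbc ih => exact ih.trans (hadj hbc)

variable {R : Type*} [CommRing R] [DecidableEq E]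

/-- The avoidance indicator with `f` re-opened is the avoidance indicator with `v` added to the mask. -/
lemma avoidInd_update_true {ends : E → Sym2 V} {m : Finset V} {u v : V} (hu : u ∈ m) (huv : u ≠ v)
    {f : E} (hf : ends f = s(u, v)) (l h : V) (x : Config E) :
    avoidInd (R := R) ends m l h (Function.update x f true) = avoidInd ends (insert v m) l h x := by
  unfold avoidInd
  have key : Function.update x f true ∈ (mconnEvent ends m l h)ᶜ ↔
      x ∈ (mconnEvent ends (insert v m) l h)ᶜ := by
    simp only [Set.mem_compl_iff, mem_mconnEvent, MConn,
      maskedGraph_update_true_reachable_iff hu huv hf x]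
  by_cases hx : Function.update x f true ∈ (mconnEvent ends m l h)ᶜ
  · rw [Set.indicator_of_mem hx, Set.indicator_of_mem (key.1 hx)]
    rfl
  · rw [Set.indicator_of_notMem hx, Set.indicator_of_notMem (fun h' => hx (key.2 h'))]

/-- The membership indicator with `f` re-opened is the one with `v` added to the mask. -/
lemma memInd_update_true {ends : E → Sym2 V} {m : Finset V} {u v : V} (hu : u ∈ m) (huv : u ≠ v)
    {f : E} (hf : ends f = s(u, v)) (r w : V) (x : Config E) :
    memInd (R := R) ends m r w (Function.update x f true) = memInd ends (insert v m) r w x := by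
  unfold memInd
  have key : Function.update x f true ∈ mconnEvent ends m r w ↔
      x ∈ mconnEvent ends (insert v m) r w := by
    simp only [mem_mconnEvent, MConn, maskedGraph_update_true_reachable_iff hu huv hf x]
  by_cases hx : Function.update x f true ∈ mconnEvent ends m r w
  · rw [Set.indicator_of_mem hx, Set.indicator_of_mem (key.1 hx)]
    rfl
  · rw [Set.indicator_of_notMem hx, Set.indicator_of_notMem (fun h' => hx (key.2 h'))]

/-- The pair kernel with `f` re-opened in the red copy is the pair kernel with the red mask enlarged
by `v`. -/
lemma pairKernel_update_true {ends : E → Sym2 V} {m m' : Finset V} {u v : V} (hu : u ∈ m)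
    (huv : u ≠ v) {f : E} (hf : ends f = s(u, v)) (l h r s o b : V) (x y : Config E) :
    pairKernel (R := R) ends m m' l h r s o b (Function.update x f true) y =
      pairKernel ends (insert v m) m' l h r s o b x y := by
  simp only [pairKernel, avoidInd_update_true hu huv hf, memInd_update_true hu huv hf]

/-- The side-sign kernel with `f` re-opened in the red copy is the side-sign kernel with the red
mask enlarged by `v`. -/
lemma sideKernel_update_true {ends : E → Sym2 V} {m m' : Finset V} {u v : V} (hu : u ∈ m)
    (huv : u ≠ v) {f : E} (hf : ends f = s(u, v)) (l h o b : V) (x y : Config E) :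
    sideKernel (R := R) ends m m' l h o b (Function.update x f true) y =
      sideKernel ends (insert v m) m' l h o b x y := by
  simp only [sideKernel, sideSign, avoidInd_update_true hu huv hf, memInd_update_true hu huv hf]

omit [DecidableEq V] [DecidableEq E] in
/-- With equal masks the pair kernel is symmetric in the two copies. -/
lemma pairKernel_comm (ends : E → Sym2 V) (m : Finset V) (l h r s o b : V) (x y : Config E) :
    pairKernel (R := R) ends m m l h r s o b x y = pairKernel ends m m l h r s o b y x := by
  simp only [pairKernel]
  ring

omit [DecidableEq V] [DecidableEq E] in
/-- With equal masks the side-sign kernel is symmetric in the two copies. -/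
lemma sideKernel_comm (ends : E → Sym2 V) (m : Finset V) (l h o b : V) (x y : Config E) :
    sideKernel (R := R) ends m m l h o b x y = sideKernel ends m m l h o b y x := by
  simp only [sideKernel]
  ring

end Shift

section Reduction

variable {V : Type*} {E : Type*} [DecidableEq V] [Fintype E] [DecidableEq E] {R : Type*}
  [CommRing R]

/-- **The one-extra-vertex reduction, pair kernels** (`MINE1-J1.md` §29(b)): for `u ∈ m`, `u ≠ v`,
`f` an edge with ends `{u, v}` free on the minor, the symmetric count with the mask `m` on both copies
is twice the nested count with the masks `(insert v m, m)` on the minor with `f` pinned closed. -/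
theorem pinnedCount_insert_pairKernel {ends : E → Sym2 V} {m : Finset V} {u v : V} (hu : u ∈ m)
    (huv : u ≠ v) {f : E} (hf : ends f = s(u, v)) {G : Finset E} (hfG : f ∉ G) (z : Config E)
    (l h r s o b : V) :
    pinnedCount (insert f G) z (pairKernel (R := R) ends m m l h r s o b) =
      2 * pinnedCount G (Function.update z f false)
        (pairKernel ends (insert v m) m l h r s o b) := by
  rw [pinnedCount_insert_eq_two_mul hfG z _ (pairKernel_comm ends m l h r s o b)]
  congr 1
  unfold pinnedCount
  refine Finset.sum_congr rfl fun x _ => ?_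
  split_ifs
  · simp only [pairKernel_update_true hu huv hf]
  · rfl

/-- **The one-extra-vertex reduction, side-sign kernel** (`MINE1-J1.md` §29(b)): every nested pair
`(insert v m, m)` count is half a symmetric `(m, m)` count on the minor with the extra free edge
`f = u–v`, `u ∈ m`. -/
theorem pinnedCount_insert_sideKernel {ends : E → Sym2 V} {m : Finset V} {u v : V} (hu : u ∈ m)
    (huv : u ≠ v) {f : E} (hf : ends f = s(u, v)) {G : Finset E} (hfG : f ∉ G) (z : Config E)
    (l h o b : V) :
    pinnedCount (insert f G) z (sideKernel (R := R) ends m m l h o b) =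
      2 * pinnedCount G (Function.update z f false) (sideKernel ends (insert v m) m l h o b) := by
  rw [pinnedCount_insert_eq_two_mul hfG z _ (sideKernel_comm ends m l h o b)]
  congr 1
  unfold pinnedCount
  refine Finset.sum_congr rfl fun x _ => ?_
  split_ifs
  · simp only [sideKernel_update_true hu huv hf]
  · rfl

variable [LinearOrder R] [IsStrictOrderedRing R]

/-- A nonnegative symmetric `(m, m)` pair count on the minor with `f` free gives a nonnegative nested
`(insert v m, m)` pair count on the minor with `f` pinned closed. -/
theorem nested_pair_nonneg_of_symmetric {ends : E → Sym2 V} {m : Finset V} {u v : V} (hu : u ∈ m)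
    (huv : u ≠ v) {f : E} (hf : ends f = s(u, v)) {G : Finset E} (hfG : f ∉ G) (z : Config E)
    (l h r s o b : V)
    (hsym : 0 ≤ pinnedCount (insert f G) z (pairKernel (R := R) ends m m l h r s o b)) :
    0 ≤ pinnedCount G (Function.update z f false) (pairKernel (R := R) ends (insert v m) m l h r s o b) := by
  rw [pinnedCount_insert_pairKernel hu huv hf hfG z l h r s o b] at hsym
  linarith

/-- A nonnegative symmetric `(m, m)` side-sign count on the minor with `f` free gives a nonnegative
nested `(insert v m, m)` side-sign count on the minor with `f` pinned closed. -/
theorem nested_side_nonneg_of_symmetric {ends : E → Sym2 V} {m : Finset V} {u v : V} (hu : u ∈ m)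
    (huv : u ≠ v) {f : E} (hf : ends f = s(u, v)) {G : Finset E} (hfG : f ∉ G) (z : Config E)
    (l h o b : V)
    (hsym : 0 ≤ pinnedCount (insert f G) z (sideKernel (R := R) ends m m l h o b)) :
    0 ≤ pinnedCount G (Function.update z f false) (sideKernel (R := R) ends (insert v m) m l h o b) := by
  rw [pinnedCount_insert_sideKernel hu huv hf hfG z l h o b] at hsym
  linarith

end Reduction

end NestedMask

end Summit.Ventures.PercRepro2
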